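import Mathlib
import HarnessLib
import Summits.HubbardSuperconductivity.HubbardSuperconductivity.Theorems.KLProgrammeKLRegimeTwoVolumeTowerBaseDefs
import Summits.HubbardSuperconductivity.HubbardSuperconductivity.Theorems.KLProgrammeKLRegimeUVCovarianceSpaceTimeRowsAt

/-!
# Route `KLProgramme` — crux K3, VL child `KLRegimeVolumeLimitV17F2` (stmt-HubbardSuperconductivity-20440), blueprint v5 M5 / W4a (symbol step): THE BASE
# COVARIANCE AS THE GRID PULL-BACK OF A NORMAL COVARIANCE WITH A VOLUME-FREE SAMPLED SYMBOL (seat hubbard-kl-k3c4-p1 g13; `--supports` 20440)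

M4a (`…TwoVolumeScaleZeroTopFrame.hubbardGrid_sum_norm_kernel_twoVolume_stepZero_le`) reads the two volumes' grid covariances as
`S_Vᵀ · normalCovariance V M p_V · S_V` with `p_V (k, σ) = (β V²) · F k.1 σ (latticeMomentum V k.2)` for ONE volume-free function `F` (periodisation).  The
covariance inside `klGridAction V M β U μ K` (`…TowerBaseDefs`) is `S_Vᵀ · C^K_{>Λ_1}(V) · S_V`; this file supplies `p_V` and `F`:

* `uvSymbolFn_volume_sampled` — `Ψ_{βV²}(Λ, e_K(k), ω) = (βV²) · Ψ_1(Λ, ξ_K(p_k), ω)` with the volume-free `ξ_K(p) = −2Σcos p_l − μ − K(p)`;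
* **`hubbardCovAboveCT_eq_normalCovariance_sampled`** — `C^K_{>Λ}(V) = normalCovariance V M p_V` with `p_V` of the displayed sampled form
  (`…UVCovarianceSpaceTimeRowsAt.hubbardCovAboveCT_eq_normalCovariance_freqFn`).

Proofs only; no definition.
-/

noncomputable section

namespace Summit.HubbardSuperconductivity.HubbardSuperconductivity.Theorems.TwoVolumeSource

set_option linter.dupNamespace false -- summit = problem name (single-conjunct summit), D-0017

open Finset Literature.MathematicalPhysics.QuantumLattice GrassmannAlgebra Literature.Probability.LatticeModels
open Literature.MathematicalPhysics.QuantumLattice.FermiRG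
open Summit.HubbardSuperconductivity.HubbardSuperconductivity.Theorems.KLProgrammeLegKernels
open Summit.HubbardSuperconductivity.HubbardSuperconductivity.Theorems.KLRegimeSplit
open Summit.HubbardSuperconductivity.HubbardSuperconductivity.Theorems.EngineV8
open Summit.HubbardSuperconductivity.HubbardSuperconductivity.Theorems.TwoVolumeDefect

/-- **The UV symbol at normalisation `βV²` is `βV²` times the unit-normalised symbol at the sampled band** `ξ_K(p) = −2Σ_l cos p_l − μ − K(p)`,
`p = latticeMomentum V k`. [cite: BenfattoGiulianiMastropietro2006, §2.1 (2.3)] -/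
theorem uvSymbolFn_volume_sampled {V : ℕ} [NeZero V] (β μ : ℝ) (K : TrigPolyC4v) (Λ ω : ℝ) (k : TorusSite 2 V) :
    uvSymbolFn (β * (V : ℝ) ^ 2) Λ (nambuXiCT V μ K k) ω =
      (((β * (V : ℝ) ^ 2 : ℝ)) : ℂ) *
        uvSymbolFn 1 Λ (-2 * ∑ l, Real.cos (latticeMomentum V k l) - μ - K.eval (latticeMomentum V k)) ω := by
  have hξ : nambuXiCT V μ K k = -2 * ∑ l, Real.cos (latticeMomentum V k l) - μ - K.eval (latticeMomentum V k) := by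
    rw [nambuXiCT, torusBand]
  rw [hξ, uvSymbolFn, uvSymbolFn, resolventFn, resolventFn]
  push_cast
  ring

/-- **`C^K_{>Λ}(V)` is the normal covariance of the sampled symbol `p_V (k, σ) = (βV²) · F k.1 σ (latticeMomentum V k.2)`**,
`F i σ p = Ψ_1(Λ, ξ_K(p), matsubaraFreq β M i)` (spin-free, volume-free). [folklore: `hubbardCovAboveCT_eq_normalCovariance_freqFn` + `uvSymbolFn_volume_sampled`] -/
theorem hubbardCovAboveCT_eq_normalCovariance_sampled {V M : ℕ} [NeZero V] [NeZero M] {β : ℝ} (hβ : 0 < β) (μ : ℝ) (K : TrigPolyC4v) (Λ : ℝ) :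
    hubbardCovAboveCT V M β μ 0 K Λ =
        normalCovariance V M (fun ks : FreqMomentum V M × Fin 2 => uvSymbolFn (β * (V : ℝ) ^ 2) Λ (nambuXiCT V μ K ks.1.2) (matsubaraFreq β M ks.1.1)) ∧
      ∀ (k : FreqMomentum V M) (σ : Fin 2),
        (fun ks : FreqMomentum V M × Fin 2 => uvSymbolFn (β * (V : ℝ) ^ 2) Λ (nambuXiCT V μ K ks.1.2) (matsubaraFreq β M ks.1.1)) (k, σ) =
          (((β * (V : ℝ) ^ 2 : ℝ)) : ℂ) *
            (fun (i : MatsubaraIdx M) (_ : Fin 2) (p : Fin 2 → ℝ) => uvSymbolFn 1 Λ (-2 * ∑ l, Real.cos (p l) - μ - K.eval p) (matsubaraFreq β M i))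
              k.1 σ (latticeMomentum V k.2) :=
  ⟨UVCovarianceAt.hubbardCovAboveCT_eq_normalCovariance_freqFn hβ μ K Λ, fun k _ => uvSymbolFn_volume_sampled β μ K Λ _ k.2⟩

end Summit.HubbardSuperconductivity.HubbardSuperconductivity.Theorems.TwoVolumeSource

end
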